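import Summits.AtomisticToContinuum.Crystallization.Theorems.FrustratedLawDichotomyStrainedPatchPhaseCut
import HarnessLib

/-!
# Stacking-phase EXCLUSIVITY of a clean site — «C-excl-1/8» proved NET-FREE (hand-2 g36, structural share for
`stmt-AtomisticToContinuum-27623`; critic rows 1348 (2) / 1349)

The two branches `FccGoodAtScale η D y i` / `HcpGoodAtScale η D y i` of `GoodAtScale` (…`StrainedPatchPhaseCut` §3) are
MUTUALLY EXCLUSIVE at every site as soon as `12 (η_f + η_h)² ≤ 1` (so in particular at the record tolerance `1/8`, where
`12 · (1/4)² = 3/4`).  Critic row 1348 (2) booked this as the CONDITIONAL support item «C-excl-1/8»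
(`HcpGoodAtScale (1/8) (3/2) y i → ¬ FccGoodAtScale (1/8) (3/2) y i`, needed by the E-side to price an hcp-class host at the
cheaper hcp branch of the family-split table), with a planned route «EXCL-18»: a float minimax over `SO(3)` (bottleneck
`0.378·d` vs `1/4·d`), an `SO(3)`-net certificate and an M-sized Lean replay (row 1349).

THIS FILE DISCHARGES IT WITHOUT ANY NET, by a parity argument:

* **general lemma first** (`exists_cross_of_fits`): two pattern fits at the same site share the nearest-neighbour scale `d`
  (clauses (ii)/(iii)), and the clean-gap clause (iv) of EITHER fit swallows every placed point of the OTHER (a placed point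
  sits at distance `∈ [(1−η)d, (1+η)d] ⊂ (0, 13/10·d)` from the centre); hence every rotated pattern point `A (P u)` of one
  fit is within `η + η'` of some rotated pattern point `A' (P' u')` of the other — for ANY two patterns of unit vectors;
* **the cuboctahedron is centrosymmetric** (`−fccInt = fccInt`, by `decide`; the tree twin
  `Literature…FlatleyTheil2015.neg_mem_fccKissingPattern` is kept private here rather than imported — its module chain is
  heavy and independent of this route) and `A_f` is linear, so
  crossing hcp → fcc → (antipode) → hcp gives, for EVERY hcp pattern point `u`, a pattern point `u'` with
  `‖u + u'‖ = ‖A_h (u + u')‖ ≤ 2 (η_f + η_h)`;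
* **the anticuboctahedron has a vertex with no approximate antipode** (`hcpKissingPattern_noAntipode`): for the
  upper-triangle vertex `u₀ = (1,1,0)/√2` every pattern point `w` has `‖u₀ + w‖² ≥ 1/3` (integer check
  `|(3,3,0) + w|² ≥ 6` over `hcpInt`, by `decide`; equality at the two lower-triangle vertices `(−1,−4,−1)/(3√2)`,
  `(−4,−1,−1)/(3√2)`).
Hence `1/3 ≤ ‖u₀ + u'‖² < 4 (η_f + η_h)² ≤ 1/3` — contradiction.  Margin at `η = 1/8`: `1/√3 − 1/2 ≈ 0.077` in the
antipode defect (the row-1349 bottleneck margin `0.128·d` is not needed).  Then **specialise**: «C-excl-1/8» both ways, the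
cap-free form at any common tolerance `η ≤ 1/7`, and the `MonoPhaseBall` branch exclusivity.

DEF-FREE; imports only the tree module `…StrainedPatchPhaseCut`; 0 sorry; standard axioms.  (The integer no-antipode check also
appears, for another purpose, in `…StrictSplittingRule.Negative.CentrosymmetricShell` — Bravais shells are centrosymmetric, so no
Bravais lattice has an hcp-close shell; its three bookkeeping lemmas are kept as PRIVATE twins here because that module sits in
the theses-cone of route FreeSplittingCertificates.)
-/

noncomputable section

open scoped BigOperators RealInnerProductSpace
open Literature.Geometry.DiscreteGeometry (fccKissingPattern hcpKissingPattern intVec sqNormInt fccInt hcpInt scaledPattern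
  norm_intVec norm_eq_one_of_mem_fccKissingPattern norm_eq_one_of_mem_hcpKissingPattern)

namespace Summit.AtomisticToContinuum.Crystallization.Theorems.FrustratedLawDichotomyStrainedPatchPhaseExclusive

open Summit.AtomisticToContinuum.Crystallization.Theorems.FrustratedLawDichotomyAveragingCut (E3)
open Summit.AtomisticToContinuum.Crystallization.Theorems.FrustratedLawDichotomyStrainedPatchPhaseCut
  (FitAtScale FccGoodAtScale HcpGoodAtScale MonoPhaseBall)

variable {N : ℕ}

/-! ## §1. The cuboctahedron is centrosymmetric; the anticuboctahedron has a vertex with no approximate antipode -/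

/-- `intVec` is additive (private twin of `…StrictSplittingRuleBirth.bravaisGap_intVec_add`, whose module
`…StrictSplittingRule.Negative.CentrosymmetricShell` lies in the theses-cone of route FreeSplittingCertificates and is therefore
not imported into this FrustratedLawDichotomy helper). [folklore] -/
private theorem intVec_add (v w : Fin 3 → ℤ) : intVec v + intVec w = intVec (v + w) := by
  ext i; simp [intVec]

/-- `intVec (−v) = −intVec v`. [folklore] -/
private theorem intVec_neg (v : Fin 3 → ℤ) : intVec (-v) = -intVec v := by
  ext i; simp [intVec]

/-- The cuboctahedron is centrally symmetric (integer model). [folklore] -/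
private theorem neg_mem_fccInt : ∀ v ∈ fccInt, -v ∈ fccInt := by
  decide

/-- `−Cub ⊆ Cub`: the point reflection preserves the fcc kissing pattern (private twin of the tree lemma
`Literature…FlatleyTheil2015.neg_mem_fccKissingPattern`, whose module is not imported here). [folklore] -/
private theorem neg_mem_fccKissingPattern {v : E3} (hv : v ∈ fccKissingPattern) : -v ∈ fccKissingPattern := by
  simp only [fccKissingPattern, scaledPattern, Finset.mem_image] at hv ⊢
  obtain ⟨w, hw, rfl⟩ := hv
  exact ⟨-w, neg_mem_fccInt w hw, by rw [intVec_neg, smul_neg]⟩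

/-- `‖intVec v‖² = |v|²` (private twin of `…StrictSplittingRuleBirth.bravaisGap_norm_intVec_sq`, see `intVec_add`). [folklore] -/
private theorem norm_intVec_sq (v : Fin 3 → ℤ) : ‖intVec v‖ ^ 2 = (sqNormInt v : ℝ) := by
  have h0 : (0 : ℝ) ≤ (sqNormInt v : ℝ) := by
    have : (0 : ℤ) ≤ sqNormInt v := by unfold sqNormInt; positivity
    exact_mod_cast this
  rw [norm_intVec, Real.sq_sqrt h0]

/-- Integer check behind `hcpKissingPattern_noAntipode`: for the upper-triangle vector `(3,3,0)` of `hcpInt` every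
`w ∈ hcpInt` has `|(3,3,0) + w|² ≥ 6` (values `6, 6, 18, 18, 24, 36, 36, 54, 54, 54, 54, 72`; private twin of
`…StrictSplittingRuleBirth.bravaisGap_six_le_sqNormInt_cap_add`, see `intVec_add`). [folklore] -/
private theorem six_le_sqNormInt_add_hcpInt : ∀ w ∈ hcpInt, (6 : ℤ) ≤ sqNormInt (![3, 3, 0] + w) := by
  decide

/-- The upper-triangle vertex `(1,1,0)/√2 = (3,3,0)/√18` belongs to the hcp kissing pattern (cf. the cap point
`…StrictSplittingRuleBirth.bravaisGap_cap_mem` of the StrictSplittingRule refutation, same vector). [folklore] -/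
theorem upperVertex_mem_hcpKissingPattern :
    (Real.sqrt (18 : ℕ))⁻¹ • intVec ![3, 3, 0] ∈ hcpKissingPattern := by
  simp only [hcpKissingPattern, scaledPattern]
  exact Finset.mem_image_of_mem _ (by decide)

/-- ★ **The anticuboctahedron is not approximately centrosymmetric**: its upper-triangle vertex `u₀ = (1,1,0)/√2` has
`‖u₀ + w‖² ≥ 1/3` for every pattern point `w` (nearest candidate antipodes: the two lower-triangle vertices
`(−1,−4,−1)/(3√2)`, `(−4,−1,−1)/(3√2)`, at distance exactly `1/√3` from `−u₀`).  Existential packaging of the same integer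
check as `…StrictSplittingRuleBirth.bravaisGap_third_le_norm_cap_add_sq` (StrictSplittingRule · Negative I, other route). [folklore] -/
theorem hcpKissingPattern_noAntipode :
    ∃ u ∈ hcpKissingPattern, ∀ w ∈ hcpKissingPattern, (1 / 3 : ℝ) ≤ ‖u + w‖ ^ 2 := by
  refine ⟨_, upperVertex_mem_hcpKissingPattern, fun w hw => ?_⟩
  simp only [hcpKissingPattern, scaledPattern, Finset.mem_image] at hw
  obtain ⟨w', hw', rfl⟩ := hw
  have h6 : (6 : ℝ) ≤ (sqNormInt (![3, 3, 0] + w') : ℝ) := by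
    exact_mod_cast six_le_sqNormInt_add_hcpInt w' hw'
  have h18 : (0 : ℝ) ≤ ((18 : ℕ) : ℝ) := by positivity
  rw [← smul_add, intVec_add, norm_smul, mul_pow, norm_intVec_sq, norm_inv, Real.norm_of_nonneg (Real.sqrt_nonneg _),
    inv_pow, Real.sq_sqrt h18]
  push_cast
  nlinarith [h6]

/-! ## §2. Crossing between two pattern fits at one site (general: any two patterns of unit vectors) -/

/-- ★★ **Cross-fit transfer.**  Two pattern fits at the same site `i` and the same scale `d` — `(P, A, t, η)` with misfit
clause `‖(t u − y i) − d·A (P u)‖ ≤ η d` and `(P', A', t', η')` likewise, the second with its clean-gap/covering clause at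
margin `γ' > 0` — and `‖P u‖ = 1`, `η ≤ 3/10`: every rotated point `A (P u)` of the first pattern is within `η + η'` of a
rotated point `A' (P' u')` of the second (the placed site `t u` lies in the punctured `13/10·d`-ball, hence is placed by
`t'` too). [this file] -/
theorem exists_cross_of_fits {ι ι' : Type*} {P : ι → E3} {P' : ι' → E3} {y : Fin N → E3} {i : Fin N}
    {d η η' γ' : ℝ} {A A' : E3 →ₗᵢ[ℝ] E3} {t : ι → E3} {t' : ι' → E3}
    (hP : ∀ u, ‖P u‖ = 1) (hd : 0 < d) (hγ' : 0 < γ') (hη : η ≤ 3 / 10)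
    (hT : ∀ u, t u ∈ Set.range y ∧ ‖(t u - y i) - d • A (P u)‖ ≤ η * d)
    (hT' : ∀ u', t' u' ∈ Set.range y ∧ ‖(t' u' - y i) - d • A' (P' u')‖ ≤ η' * d)
    (hgap' : ∀ s : E3, s ∈ Set.range y → s ≠ y i → dist s (y i) < 13 / 10 * d + γ' →
      dist s (y i) ≤ 13 / 10 * d - γ' ∧ s ∈ Set.range t')
    (u : ι) : ∃ u' : ι', ‖A (P u) - A' (P' u')‖ ≤ η + η' := by
  obtain ⟨hty, htu⟩ := hT u
  have hnorm : ‖d • A (P u)‖ = d := by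
    rw [norm_smul, Real.norm_of_nonneg hd.le, A.norm_map, hP, mul_one]
  have hηd : η * d ≤ 3 / 10 * d := mul_le_mul_of_nonneg_right hη hd.le
  have hne : t u ≠ y i := by
    intro h
    rw [h, sub_self, zero_sub, norm_neg, hnorm] at htu
    linarith
  have hdist : dist (t u) (y i) < 13 / 10 * d + γ' := by
    have e : t u - y i = d • A (P u) + ((t u - y i) - d • A (P u)) := by abel
    rw [dist_eq_norm, e]
    have := norm_add_le (d • A (P u)) ((t u - y i) - d • A (P u))
    rw [hnorm] at this
    linarith
  obtain ⟨-, u', hu'⟩ := hgap' (t u) hty hne hdist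
  refine ⟨u', ?_⟩
  obtain ⟨-, htu'⟩ := hT' u'
  rw [hu'] at htu'
  have e : d • A (P u) - d • A' (P' u') = ((t u - y i) - d • A' (P' u')) - ((t u - y i) - d • A (P u)) := by abel
  have key : ‖d • A (P u) - d • A' (P' u')‖ ≤ (η + η') * d := by
    rw [e]
    exact (norm_sub_le _ _).trans (by linarith)
  rw [← smul_sub, norm_smul, Real.norm_of_nonneg hd.le, mul_comm] at key
  exact le_of_mul_le_mul_right key hd

/-! ## §3. Exclusivity (general tolerance), then the record specialisations -/

/-- ★★★ **fcc/hcp exclusivity of a site (general tolerances).**  No site of any finite configuration is both fcc-good at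
tolerance `η_f` and hcp-good at tolerance `η_h` (any scale caps) when `η_f, η_h ≤ 3/10` and `12 (η_f + η_h)² ≤ 1`.
Proof: common scale (pinning clauses), cross hcp → fcc at the no-antipode vertex `u₀`, antipode in the cuboctahedron,
cross back fcc → hcp: `‖u₀ + u'‖ ≤ 2 (η_f' + η_h') < 2 (η_f + η_h)`, against `‖u₀ + u'‖² ≥ 1/3`. [this file] -/
theorem fcc_hcp_exclusive {y : Fin N → E3} {i : Fin N} {ηf ηh Df Dh : ℝ}
    (hηf : ηf ≤ 3 / 10) (hηh : ηh ≤ 3 / 10) (hsum : 12 * (ηf + ηh) ^ 2 ≤ 1)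
    (hF : FccGoodAtScale ηf Df y i) (hH : HcpGoodAtScale ηh Dh y i) : False := by
  obtain ⟨df, ηf', γf, Af, -, tf, hdf, hγf, hηf', hTf, hpinf, hpinf', hgapf⟩ := hF
  obtain ⟨dh, ηh', γh, Ah, -, th, hdh, hγh, hηh', hTh, hpinh, hpinh', hgaph⟩ := hH
  obtain ⟨sf, hsf, hsfne, hsfd⟩ := hpinf'
  obtain ⟨sh, hsh, hshne, hshd⟩ := hpinh'
  have hd : dh = df := le_antisymm ((hpinh sf hsf hsfne).trans hsfd) ((hpinf sh hsh hshne).trans hshd)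
  subst hd
  have hPf : ∀ u : ↥fccKissingPattern, ‖(fun u : ↥fccKissingPattern => (u : E3)) u‖ = 1 :=
    fun u => norm_eq_one_of_mem_fccKissingPattern u.2
  have hPh : ∀ u : ↥hcpKissingPattern, ‖(fun u : ↥hcpKissingPattern => (u : E3)) u‖ = 1 :=
    fun u => norm_eq_one_of_mem_hcpKissingPattern u.2
  obtain ⟨u₀, hu₀, hanti⟩ := hcpKissingPattern_noAntipode
  -- hcp vertex `u₀` ↦ an fcc vertex `v` with `‖A_h u₀ − A_f v‖ ≤ η_h' + η_f'`
  obtain ⟨v, hv⟩ := exists_cross_of_fits hPh hdf hγf (hηh'.le.trans hηh) hTh hTf hgapf ⟨u₀, hu₀⟩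
  -- the antipode `−v` is an fcc vertex ↦ an hcp vertex `u'` with `‖A_f (−v) − A_h u'‖ ≤ η_f' + η_h'`
  obtain ⟨u', hu'⟩ :=
    exists_cross_of_fits hPf hdf hγh (hηf'.le.trans hηf) hTf hTh hgaph ⟨-(v : E3), neg_mem_fccKissingPattern v.2⟩
  have hv' : ‖Ah u₀ - Af (v : E3)‖ ≤ ηh' + ηf' := hv
  have hu'' : ‖Af (-(v : E3)) - Ah (u' : E3)‖ ≤ ηf' + ηh' := hu'
  have h1 : ‖u₀ + (u' : E3)‖ ≤ 2 * (ηf' + ηh') := by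
    rw [← Ah.norm_map, map_add]
    have e : Ah u₀ + Ah (u' : E3) = (Ah u₀ - Af (v : E3)) - (Af (-(v : E3)) - Ah (u' : E3)) := by
      rw [map_neg]; abel
    rw [e]
    exact (norm_sub_le _ _).trans (by linarith)
  have h2 : (1 / 3 : ℝ) ≤ ‖u₀ + (u' : E3)‖ ^ 2 := hanti _ u'.2
  have h3 : ‖u₀ + (u' : E3)‖ < 2 * (ηf + ηh) := by linarith
  have h4 : 0 ≤ ‖u₀ + (u' : E3)‖ := norm_nonneg _
  nlinarith [mul_lt_mul'' h3 h3 h4 h4]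

/-- ★★★ **«C-excl-1/8»** (critic row 1348 (2), as booked): an hcp-good site at (`1/8`, `3/2`) is NOT fcc-good at (`1/8`, `3/2`)
(`12 · (1/8 + 1/8)² = 3/4 ≤ 1`). [this file] -/
theorem not_fccGoodAtScale_of_hcpGoodAtScale {y : Fin N → E3} {i : Fin N}
    (h : HcpGoodAtScale (1 / 8) (3 / 2) y i) : ¬ FccGoodAtScale (1 / 8) (3 / 2) y i := fun hF =>
  fcc_hcp_exclusive (by norm_num) (by norm_num) (by norm_num) hF h

/-- ★★★ **«C-excl-1/8», converse direction**: an fcc-good site at (`1/8`, `3/2`) is NOT hcp-good at (`1/8`, `3/2`). [this file] -/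
theorem not_hcpGoodAtScale_of_fccGoodAtScale {y : Fin N → E3} {i : Fin N}
    (h : FccGoodAtScale (1 / 8) (3 / 2) y i) : ¬ HcpGoodAtScale (1 / 8) (3 / 2) y i := fun hH =>
  fcc_hcp_exclusive (by norm_num) (by norm_num) (by norm_num) h hH

/-- The tolerance of an hcp fit is positive (the pattern is nonempty and the misfit clause reads `0 ≤ ‖…‖ ≤ η' d` with
`η' < η`, `d > 0`). [this file] -/
theorem eta_pos_of_hcpGoodAtScale {y : Fin N → E3} {i : Fin N} {η D : ℝ} (h : HcpGoodAtScale η D y i) : 0 < η := by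
  obtain ⟨d, η', γ, A, -, t, hd, -, hη', hT, -, -, -⟩ := h
  obtain ⟨-, hu⟩ := hT ⟨_, upperVertex_mem_hcpKissingPattern⟩
  have h0 : 0 ≤ η' * d := (norm_nonneg _).trans hu
  nlinarith

/-- ★★ **Cap-free, common-tolerance form**: at any common tolerance `η ≤ 1/7` (`12 · (2/7)² = 48/49`) and any two scale caps,
fcc-good excludes hcp-good. [this file] -/
theorem not_hcpGoodAtScale_of_fccGoodAtScale_of_le {y : Fin N → E3} {i : Fin N} {η Df Dh : ℝ} (hη : η ≤ 1 / 7)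
    (h : FccGoodAtScale η Df y i) : ¬ HcpGoodAtScale η Dh y i := fun hH =>
  have hpos : 0 < η := eta_pos_of_hcpGoodAtScale hH
  fcc_hcp_exclusive (by linarith) (by linarith) (by nlinarith) h hH

/-- ★★ **Mixed tolerances** `1/20` (tight) vs `1/8` (loose), either phase either way: `12 · (1/20 + 1/8)² = 147/400`. [this file] -/
theorem not_hcpGoodAtScale_eighth_of_fccGoodAtScale_twentieth {y : Fin N → E3} {i : Fin N} {Df Dh : ℝ}
    (h : FccGoodAtScale (1 / 20) Df y i) : ¬ HcpGoodAtScale (1 / 8) Dh y i := fun hH =>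
  fcc_hcp_exclusive (by norm_num) (by norm_num) (by norm_num) h hH

/-- ★★ Mixed tolerances, the other phase: hcp-good at `1/20` excludes fcc-good at `1/8`. [this file] -/
theorem not_fccGoodAtScale_eighth_of_hcpGoodAtScale_twentieth {y : Fin N → E3} {i : Fin N} {Df Dh : ℝ}
    (h : HcpGoodAtScale (1 / 20) Dh y i) : ¬ FccGoodAtScale (1 / 8) Df y i := fun hF =>
  fcc_hcp_exclusive (by norm_num) (by norm_num) (by norm_num) hF h

/-- ★★ **The two branches of a pure stacking word are exclusive** (`MonoPhaseBall r₁ z c`, `0 ≤ r₁`: the centre itself is a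
site within `r₁`, fcc-good or hcp-good but not both). [this file] -/
theorem monoPhaseBall_branches_exclusive {r₁ : ℝ} {M : ℕ} {z : Fin M → E3} {c : Fin M} (hr : 0 ≤ r₁) :
    ¬ ((∀ a : Fin M, dist (z a) (z c) ≤ r₁ → FccGoodAtScale (1 / 8) (3 / 2) z a) ∧
        (∀ a : Fin M, dist (z a) (z c) ≤ r₁ → HcpGoodAtScale (1 / 8) (3 / 2) z a)) := by
  rintro ⟨hf, hh⟩
  have h0 : dist (z c) (z c) ≤ r₁ := by rw [dist_self]; exact hr
  exact not_hcpGoodAtScale_of_fccGoodAtScale (hf c h0) (hh c h0)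

/-- ★★ **Phase of a pure word is well defined**: under `MonoPhaseBall r₁ z c` with `0 ≤ r₁`, the word is fcc IFF the centre is
fcc-good, and then NO site within `r₁` is hcp-good. [this file] -/
theorem monoPhaseBall_fcc_iff_centre {r₁ : ℝ} {M : ℕ} {z : Fin M → E3} {c : Fin M} (hr : 0 ≤ r₁)
    (h : MonoPhaseBall r₁ z c) :
    (∀ a : Fin M, dist (z a) (z c) ≤ r₁ → FccGoodAtScale (1 / 8) (3 / 2) z a) ↔ FccGoodAtScale (1 / 8) (3 / 2) z c := by
  have h0 : dist (z c) (z c) ≤ r₁ := by rw [dist_self]; exact hr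
  refine ⟨fun hf => hf c h0, fun hc => ?_⟩
  rcases h with hf | hh
  · exact hf
  · exact absurd (hh c h0) (not_hcpGoodAtScale_of_fccGoodAtScale hc)

/-! ## §4. Phase coherence across the tolerance window (appended, hand-2 g36) -/

open Summit.AtomisticToContinuum.Crystallization.Theorems.FrustratedLawDichotomyMotifLemmas (GoodAtScale)
open Summit.AtomisticToContinuum.Crystallization.Theorems.FrustratedLawDichotomyStrainedPatchPhaseCut (goodAtScale_iff_fcc_or_hcp)

/-- The cuboctahedron vertex `(1,1,0)/√2` belongs to the fcc kissing pattern. [folklore] -/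
theorem upperVertex_mem_fccKissingPattern :
    (Real.sqrt (2 : ℕ))⁻¹ • intVec ![1, 1, 0] ∈ fccKissingPattern := by
  simp only [fccKissingPattern, scaledPattern]
  exact Finset.mem_image_of_mem _ (by decide)

/-- The tolerance of an fcc fit is positive (as `eta_pos_of_hcpGoodAtScale`). [this file] -/
theorem eta_pos_of_fccGoodAtScale {y : Fin N → E3} {i : Fin N} {η D : ℝ} (h : FccGoodAtScale η D y i) : 0 < η := by
  obtain ⟨d, η', γ, A, -, t, hd, -, hη', hT, -, -, -⟩ := h
  obtain ⟨-, hu⟩ := hT ⟨_, upperVertex_mem_fccKissingPattern⟩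
  have h0 : 0 ≤ η' * d := (norm_nonneg _).trans hu
  nlinarith

/-- The tolerance of a good site (either phase) is positive. [this file] -/
theorem eta_pos_of_goodAtScale {y : Fin N → E3} {i : Fin N} {η D : ℝ} (h : GoodAtScale η D y i) : 0 < η := by
  rcases goodAtScale_iff_fcc_or_hcp.1 h with hF | hH
  · exact eta_pos_of_fccGoodAtScale hF
  · exact eta_pos_of_hcpGoodAtScale hH

/-- ★★ **Phase coherence (general tolerances)**: a site that is fcc-good at tolerance `η'` and good (either phase) at tolerance `η`,
with `η, η' ≤ 3/10` and `12 (η + η')² ≤ 1`, is fcc-good AT TOLERANCE `η` (any caps) — the tighter fit cannot switch phase. [this file] -/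
theorem fccGoodAtScale_of_goodAtScale_of_fcc {y : Fin N → E3} {i : Fin N} {η η' D D' : ℝ}
    (hη : η ≤ 3 / 10) (hη' : η' ≤ 3 / 10) (hsum : 12 * (η + η') ^ 2 ≤ 1)
    (hF : FccGoodAtScale η' D' y i) (hg : GoodAtScale η D y i) : FccGoodAtScale η D y i :=
  (goodAtScale_iff_fcc_or_hcp.1 hg).resolve_right fun hH =>
    fcc_hcp_exclusive hη' hη (by rwa [add_comm] at hsum) hF hH

/-- ★★ Phase coherence, hcp side: hcp-good at `η'` and good at `η` (`η, η' ≤ 3/10`, `12 (η + η')² ≤ 1`) ⇒ hcp-good at `η`. [this file] -/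
theorem hcpGoodAtScale_of_goodAtScale_of_hcp {y : Fin N → E3} {i : Fin N} {η η' D D' : ℝ}
    (hη : η ≤ 3 / 10) (hη' : η' ≤ 3 / 10) (hsum : 12 * (η + η') ^ 2 ≤ 1)
    (hH : HcpGoodAtScale η' D' y i) (hg : GoodAtScale η D y i) : HcpGoodAtScale η D y i :=
  (goodAtScale_iff_fcc_or_hcp.1 hg).resolve_left fun hF => fcc_hcp_exclusive hη hη' hsum hF hH

/-- ★★★ **Phase coherence at the record classification** (`1/8`): an fcc-good site at (`1/8`, `D'`) that is good at ANY tolerance `η ≤ 1/8`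
(e.g. at its fit level) is fcc-good at that tolerance — the phase-aware tables' fcc row (chosen by `FccGoodAtScale (1/8) (3/2)`) describes the
phase of EVERY tighter fit of the same site. [this file] -/
theorem fccGoodAtScale_of_goodAtScale_of_fcc_eighth {y : Fin N → E3} {i : Fin N} {η D D' : ℝ} (hη : η ≤ 1 / 8)
    (hF : FccGoodAtScale (1 / 8) D' y i) (hg : GoodAtScale η D y i) : FccGoodAtScale η D y i :=
  have hpos : 0 < η := eta_pos_of_goodAtScale hg
  fccGoodAtScale_of_goodAtScale_of_fcc (by linarith) (by norm_num) (by nlinarith) hF hg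

/-- ★★★ Phase coherence at `1/8`, hcp side: hcp-good at (`1/8`, `D'`) and good at `η ≤ 1/8` ⇒ hcp-good at `η`. [this file] -/
theorem hcpGoodAtScale_of_goodAtScale_of_hcp_eighth {y : Fin N → E3} {i : Fin N} {η D D' : ℝ} (hη : η ≤ 1 / 8)
    (hH : HcpGoodAtScale (1 / 8) D' y i) (hg : GoodAtScale η D y i) : HcpGoodAtScale η D y i :=
  have hpos : 0 < η := eta_pos_of_goodAtScale hg
  hcpGoodAtScale_of_goodAtScale_of_hcp (by linarith) (by norm_num) (by nlinarith) hH hg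

/-! ## §5. A clean ball without a pure word is GENUINELY TWO-PHASE; the first word change sits in the annulus (appended, hand-2 g36) -/

open Summit.AtomisticToContinuum.Crystallization.Theorems.FrustratedLawDichotomyStrainedPatchCleanCollar (CleanBall)

/-- ★★ **Faulted clean balls are two-phase.**  For a ball clean within `r₁` (`CleanBall r₁ z c`: every site within `r₁` is good at
(`1/8`, `3/2`)), NOT having a pure stacking word out to `r₁` (`¬ MonoPhaseBall r₁ z c` — the hypothesis of `PolyTextureFloor`) is EQUIVALENT to
the presence of BOTH an fcc-good site AND an hcp-good site within `r₁` (a genuine stacking fault; `⇐` is exclusivity). [this file] -/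
theorem not_monoPhaseBall_iff_two_phase {r₁ : ℝ} {M : ℕ} {z : Fin M → E3} {c : Fin M} (hC : CleanBall r₁ z c) :
    ¬ MonoPhaseBall r₁ z c ↔
      (∃ a : Fin M, dist (z a) (z c) ≤ r₁ ∧ FccGoodAtScale (1 / 8) (3 / 2) z a) ∧
        (∃ b : Fin M, dist (z b) (z c) ≤ r₁ ∧ HcpGoodAtScale (1 / 8) (3 / 2) z b) := by
  constructor
  · intro hn
    unfold MonoPhaseBall at hn
    push Not at hn
    obtain ⟨⟨a, ha, hna⟩, ⟨b, hb, hnb⟩⟩ := hn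
    exact ⟨⟨b, hb, (goodAtScale_iff_fcc_or_hcp.1 (hC b hb)).resolve_right hnb⟩,
      ⟨a, ha, (goodAtScale_iff_fcc_or_hcp.1 (hC a ha)).resolve_left hna⟩⟩
  · rintro ⟨⟨a, ha, hFa⟩, ⟨b, hb, hHb⟩⟩ hm
    unfold MonoPhaseBall at hm
    rcases hm with h | h
    · exact not_hcpGoodAtScale_of_fccGoodAtScale (h b hb) hHb
    · exact not_fccGoodAtScale_of_hcpGoodAtScale (h a ha) hFa

/-- ★★ **The first word change sits in the annulus.**  A pure word out to `r₁` that does NOT extend to `r₂`, in a ball clean within `r₂`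
(the hypotheses of `AnnularPhaseFloor r r₁ r₂ φ`), has a site of the OTHER phase at distance `∈ (r₁, r₂]` from the centre: either the word is fcc
and an hcp-good site lies in the annulus, or the word is hcp and an fcc-good site lies there (exclusivity keeps the foreign site out of the
inner ball). [this file] -/
theorem annulus_fault_of_monoPhaseBall_of_not {r₁ r₂ : ℝ} {M : ℕ} {z : Fin M → E3} {c : Fin M} (hM : MonoPhaseBall r₁ z c)
    (hn : ¬ MonoPhaseBall r₂ z c) (hC : CleanBall r₂ z c) :
    ((∀ a : Fin M, dist (z a) (z c) ≤ r₁ → FccGoodAtScale (1 / 8) (3 / 2) z a) ∧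
        ∃ b : Fin M, r₁ < dist (z b) (z c) ∧ dist (z b) (z c) ≤ r₂ ∧ HcpGoodAtScale (1 / 8) (3 / 2) z b) ∨
      ((∀ a : Fin M, dist (z a) (z c) ≤ r₁ → HcpGoodAtScale (1 / 8) (3 / 2) z a) ∧
        ∃ b : Fin M, r₁ < dist (z b) (z c) ∧ dist (z b) (z c) ≤ r₂ ∧ FccGoodAtScale (1 / 8) (3 / 2) z b) := by
  obtain ⟨⟨a, ha, hFa⟩, ⟨b, hb, hHb⟩⟩ := (not_monoPhaseBall_iff_two_phase hC).1 hn
  unfold MonoPhaseBall at hM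
  rcases hM with h | h
  · refine Or.inl ⟨h, b, ?_, hb, hHb⟩
    by_contra hle
    exact not_hcpGoodAtScale_of_fccGoodAtScale (h b (not_lt.1 hle)) hHb
  · refine Or.inr ⟨h, a, ?_, ha, hFa⟩
    by_contra hle
    exact not_fccGoodAtScale_of_hcpGoodAtScale (h a (not_lt.1 hle)) hFa

/-- Consequently the inner word radius is strictly below the outer one whenever the word fails to extend (`r₁ < r₂`). [this file] -/
theorem lt_of_monoPhaseBall_of_not {r₁ r₂ : ℝ} {M : ℕ} {z : Fin M → E3} {c : Fin M} (hM : MonoPhaseBall r₁ z c)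
    (hn : ¬ MonoPhaseBall r₂ z c) (hC : CleanBall r₂ z c) : r₁ < r₂ := by
  rcases annulus_fault_of_monoPhaseBall_of_not hM hn hC with ⟨-, b, h1, h2, -⟩ | ⟨-, b, h1, h2, -⟩ <;> exact h1.trans_le h2

end Summit.AtomisticToContinuum.Crystallization.Theorems.FrustratedLawDichotomyStrainedPatchPhaseExclusive

end
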